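import Literature.MathematicalPhysics.QuantumFieldTheory.Balaban1983to89.B9Thm310WholeDir

/-!
# `Balaban1983to89.B9RWSums343HolderDir` — the (3.43) Hölder members of Theorem 3.10's sum G(U) OVER THE DIRECTION LETTERS (R1′-A): n06-k's `B9RWSums343Holder.holder343_of_local310` with `Identities310₂`

T. Bałaban, *Propagators for lattice gauge theories in a background field*, Commun. Math. Phys. **99** (1985) 389–434
[`Balaban1985BackgroundPropagators`, "B9"], Thm 3.10 (3.105)–(3.108) pp. 414–416, (3.43)–(3.46) p. 398, (3.42) p. 397, Cor. 3.6 p. 408; T. Bałaban,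
*Propagators and renormalization transformations for lattice gauge theories. II*, Commun. Math. Phys. **96** (1984) 223–250 [`Balaban1984PropagatorsII`, "[4]"],
(2.52)–(2.55) p. 232, Lemma 2.1 p. 234.

statement-level skeleton of published theorems with citation tags; proofs where landed; nothing here is a claim about the
Yang–Mills mass gap

WHY THIS FILE (cell `pub-ymgap`, Track A node N06 [B9], row 19; seat `pub-ymgap-dag-n06-c` g10, LOCATED-9 bus l.32219, R1′-A).  The G-side member faces of
the lineage take `hi : Identities310`; over the direction letters they take `hi : Identities310₂ 𝔬 𝔡 𝔩 R H U` (`B9Thm310WholeDir`) — a TYPE-ONLY re-thread: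
every proof reads `hi` through `inv ∕ invT ∕ eq3105 ∕ eq3105T` only, which `Identities310₂` keeps verbatim.  v1 private helpers are copied (private there);
statements, constants and every other hypothesis VERBATIM.

HONEST SCOPE.  Majorant bookkeeping over n06-k's landed calculus; legs, factor bounds and (3.105)–(3.106) are HYPOTHESES (schemas); nothing of [B9] asserted;
COUNT-NEUTRAL; N06 NOT discharged; one finite lattice programme — nothing continuum, nothing about OS positivity or the mass gap.
-/

namespace Literature.MathematicalPhysics.QuantumFieldTheory.Balaban1983to89.B9RWSums343HolderDir

open Finset B6RandomWalk B6RandomWalkHom B9Thm37Sum B9Thm34Ext B9Thm37Glue B9Thm37Whole B9Cor38Whole B9Thm310Whole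
open B9RWSums343to347Whole B9RWSums346Schur B9Thm37GlueCor36
open B9RWSums343Holder B9RWSums346SecondDiff B9Thm37WholeDir B9Thm310WholeDir

noncomputable section

section GSide

variable {g : B9.Geometry} [Fintype g.Site] [DecidableEq g.Site] {R : ℝ} {H : Prop} {B : B9.Backgrounds}
variable {X Y ι A PX PY Dir : Type} [Fintype Dir]

omit [Fintype g.Site] [DecidableEq g.Site] in
/-- The constant is ≧ 0 for nonnegative letters. [folklore] -/
private theorem holderConst_nonneg' {d : ℕ} {δ₀ α NH NF C b t : ℝ} (hNH : 0 ≤ NH) (hNF : 0 ≤ NF) (hC : 0 ≤ C) (hb : 0 ≤ b)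
    (ht : 0 ≤ t) : 0 ≤ holderConst d δ₀ α NH NF C b t := by
  have hc1 : 0 ≤ B6.c1 d δ₀ α := c1_nonneg d δ₀ α
  unfold holderConst
  positivity

/-- ★ **(v2 OVER THE DIRECTION LETTERS, R1′-A: `hi : Identities310₂`; otherwise VERBATIM `B9RWSums343Holder.holder343_of_local310`.)** **THE MEMBER (3.43) OF THE SUM G(U) OF (3.107) AT ONE MEMBER AND ONE CONFIGURATION U — both probe majorants.**  LEFT:
Φ^Y_β∘∇_U∘G = Φ^Y_β∘∇_U∘G₀ + (Φ^Y_β∘∇_U∘G)∘R from G = G₀ + GR ((3.106), `B9Thm37Sum.fixedPoint_of_388` on GΔ_a = I and (3.105)),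
the Hölder legs summed with the overlap count N_H, the factors' sup majorant N_Fθ₀M⁻¹e^{−δ₀d} (`Factors389.fac`) and
`leftMember_of_localLegs`; RIGHT: Φ^X_β∘(G∘∇\*_U) = Φ^X_β∘(G₀∘∇\*_U) + (Φ^X_β∘ΣR♯_a)∘(G∘∇\*_U) from the transposed (3.105)
(`B9Thm37Glue.fixedPoint_of_388T`), the right legs, the probe bounds of the transposed factors (`FactorsHolder310`), the entry-3
sup majorant C·L^jη·e^{−δd} of the sum (`Conv3107`, third conjunct) and `rightMember_of_localLegs`.  For 0 ≦ δ ≦ (1 − α)δ₀,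
M ≧ 1 and the located smallness N_Fθ₀M⁻¹c₁(α) ≦ ½, BOTH members have the majorant `holderConst …`(β)·(L^jη)^{1−β}e^{−δd(y,y′)}.
[cite: Balaban1985BackgroundPropagators, Thm 3.10 (3.105)–(3.108) pp.414–416 + (3.43) p.398 + p.413; Balaban1984PropagatorsII, Prop 2.2 (2.66) p.234] -/
theorem holder343_of_local310_dir [Fintype X] [DecidableEq X] [Fintype Y] [DecidableEq Y] [Fintype ι] [Fintype A]
    [Fintype PX] [DecidableEq PX] [Fintype PY] [DecidableEq PY]
    (𝔬 : Ops310 g B X Y ι A) (𝔡 : DirOps310 𝔬 Dir) (𝔩 : DirLetters310 𝔬 Dir) (𝔭 : HolderProbes g B X Y PX PY) (R : ℝ) (H : Prop) (d : ℕ)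
    (δ₀ α ρ N N' NF Cℓ θ₀ NH C δ : ℝ) (κ : Sizes310) (SH : ι → Finset g.Site) (Bl θH : ℝ → ℝ) (U : B.Cfg)
    (hδ₀ : 0 ≤ δ₀) (hα : 0 ≤ α) (hα1 : α ≤ 1) (hNF : 0 ≤ NF) (hθ₀ : 0 ≤ θ₀) (hNH : 0 ≤ NH) (hM : 1 ≤ g.M)
    (hC : 0 ≤ C) (hδ : 0 ≤ δ) (hδle : δ ≤ (1 - α) * δ₀)
    (hs : StaticOK310 𝔬 ρ N N' NF Cℓ κ) (hcntH : ∀ a : g.Site, (∑ i, if a ∈ SH i then (1 : ℝ) else 0) ≤ NH)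
    (hBl : ∀ β, 0 ≤ β → β < 1 → 0 ≤ Bl β) (hθH : ∀ β, 0 ≤ β → β < 1 → 0 ≤ θH β)
    (h261 : Ineq261 d (toB6 g R H) δ₀ α) (hq : NF * (θ₀ * g.M⁻¹) * B6.c1 d δ₀ α ≤ 1 / 2)
    (hf : Factors389 𝔬 R H θ₀ δ₀ U) (hi : Identities310₂ 𝔬 𝔡 𝔩 R H U)
    (hL : HolderLegs310 𝔬 𝔭 R H SH Bl δ₀ U) (hF : FactorsHolder310 𝔬 𝔭 R H θH δ₀ U)
    (h2 : HasMajorantHom (g := toB6 g R H) 𝔬.blkY 𝔬.blk (𝔬.G U ∘ₗ 𝔬.Dstar U)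
      (fun (a b : g.Site) => C * g.len a * Real.exp (-(δ * g.dist a b)))) :
    ∀ β : ℝ, 0 ≤ β → β < 1 →
      HasMajorantHom (g := toB6 g R H) 𝔬.blk 𝔭.blkPY ((𝔭.ΦY U β ∘ₗ 𝔬.D U) ∘ₗ 𝔬.G U)
          (fun (a b : g.Site) => holderConst d δ₀ α NH NF C (Bl β) (θH β) * g.len a ^ (1 - β) *
            Real.exp (-(δ * g.dist a b))) ∧
        HasMajorantHom (g := toB6 g R H) 𝔬.blkY 𝔭.blkPX (𝔭.ΦX U β ∘ₗ (𝔬.G U ∘ₗ 𝔬.Dstar U))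
          (fun (a b : g.Site) => holderConst d δ₀ α NH NF C (Bl β) (θH β) * g.len a ^ (1 - β) *
            Real.exp (-(δ * g.dist a b))) := by
  intro β hβ0 hβ1
  have hMpos : 0 < g.M := lt_of_lt_of_le one_pos hM
  have hMinv : g.M⁻¹ ≤ 1 := inv_le_one_of_one_le₀ hM
  have hMinv0 : 0 ≤ g.M⁻¹ := inv_nonneg.mpr hMpos.le
  have hlen : ∀ y : g.Site, 0 ≤ g.len y := fun y => (hs.lenpos y).le
  have hW : ∀ y : g.Site, 0 ≤ g.len y ^ (1 - β) := fun y => Real.rpow_nonneg (hlen y) _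
  have htri : Triangle254 (toB6 g R H) := fun a b c => hs.tri a b c
  have hc1 : 0 ≤ B6.c1 d δ₀ α := c1_nonneg d δ₀ α
  have hθM : 0 ≤ θ₀ * g.M⁻¹ := mul_nonneg hθ₀ hMinv0
  have hθ : 0 ≤ NF * (θ₀ * g.M⁻¹) := mul_nonneg hNF hθM
  have hsmall : NF * (θ₀ * g.M⁻¹) * B6.c1 d δ₀ α < 1 := by linarith
  have hb : 0 ≤ Bl β := hBl β hβ0 hβ1
  have ht : 0 ≤ θH β := hθH β hβ0 hβ1
  have hαδ₀ : 0 ≤ α * δ₀ := mul_nonneg hα hδ₀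
  have hexp : ∀ a b : g.Site, Real.exp (-((1 - α) * δ₀ * g.dist a b)) ≤ Real.exp (-(δ * g.dist a b)) := fun a b =>
    Real.exp_le_exp.mpr (neg_le_neg (mul_le_mul_of_nonneg_right hδle (hs.dnn a b)))
  -- R = Σ_a R_a has majorant N_F·θ₀M⁻¹·e^{−δ₀d}
  have hRa : ∀ a : A, HasMajorant (g := toB6 g R H) 𝔬.blk (𝔬.Rf U a)
      (fun (y y' : g.Site) => (if y ∈ 𝔬.SF a then (1 : ℝ) else 0) * (θ₀ * g.M⁻¹ * Real.exp (-(δ₀ * g.dist y y')))) :=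
    fun a => hasMajorant_mono (g := toB6 g R H) 𝔬.blk (hf.fac a) fun y y' => le_of_eq (by split_ifs <;> simp)
  have hR : HasMajorant (g := toB6 g R H) 𝔬.blk (∑ a, 𝔬.Rf U a)
      (fun (y y' : g.Site) => NF * (θ₀ * g.M⁻¹) * Real.exp (-(δ₀ * g.dist y y'))) := by
    have hloc := hasMajorant_localSum (G := toB6 g R H) 𝔬.blk (fun a => 𝔬.Rf U a)
      (fun a (y : g.Site) => if y ∈ 𝔬.SF a then (1 : ℝ) else 0)
      (fun (y y' : g.Site) => θ₀ * g.M⁻¹ * Real.exp (-(δ₀ * g.dist y y'))) NF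
      (fun y y' => mul_nonneg hθM (Real.exp_nonneg _)) hRa hs.cntF
    exact hasMajorant_mono (g := toB6 g R H) 𝔬.blk hloc fun y y' => le_of_eq (by ring)
  -- (3.106): G = G₀ + GR
  have hfix : 𝔬.G U = (∑ i, mulOp (𝔬.h i) * 𝔬.Gsq U i * mulOp (𝔬.h i)) + 𝔬.G U * ∑ a, 𝔬.Rf U a :=
    fixedPoint_of_388 hi.inv hi.eq3105
  -- LEFT member
  have eL := leftMember_of_localLegs (R := R) (H := H) 𝔬.blk 𝔭.blkPY d δ₀ α (NF * (θ₀ * g.M⁻¹)) (Bl β) NH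
    (fun y => g.len y ^ (1 - β)) (fun i (a : g.Site) => if a ∈ SH i then (1 : ℝ) else 0) hb hNH hW hθ hδ₀ hα1 htri
    hs.refl hs.dnn h261 hsmall hcntH hfix hR (hL.left β hβ0 hβ1)
  -- RIGHT member: the transposed (3.105)
  have hGT : 𝔬.G U = (∑ i, mulOp (𝔬.h i) * 𝔬.Gsq U i * mulOp (𝔬.h i)) + (∑ a, 𝔬.Rt U a) * 𝔬.G U :=
    fixedPoint_of_388T hi.invT hi.eq3105T
  have hsumD : (∑ i, mulOp (𝔬.h i) * 𝔬.Gsq U i * mulOp (𝔬.h i)) ∘ₗ 𝔬.Dstar U =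
      ∑ i, (mulOp (𝔬.h i) * 𝔬.Gsq U i * mulOp (𝔬.h i)) ∘ₗ 𝔬.Dstar U := by
    apply LinearMap.ext
    intro μ
    simp only [LinearMap.comp_apply, LinearMap.sum_apply]
  have hfixT : 𝔬.G U ∘ₗ 𝔬.Dstar U = (∑ i, (mulOp (𝔬.h i) * 𝔬.Gsq U i * mulOp (𝔬.h i)) ∘ₗ 𝔬.Dstar U) +
      (∑ a, 𝔬.Rt U a) ∘ₗ (𝔬.G U ∘ₗ 𝔬.Dstar U) := by
    conv_lhs => rw [hGT]
    rw [LinearMap.add_comp, Module.End.mul_eq_comp, LinearMap.comp_assoc, hsumD]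
  -- Φ^X∘ΣR♯_a: the probe bounds of the transposed factors summed with N_F
  have hsumV : 𝔭.ΦX U β ∘ₗ (∑ a, 𝔬.Rt U a) = ∑ a, 𝔭.ΦX U β ∘ₗ 𝔬.Rt U a := by
    apply LinearMap.ext
    intro μ
    rw [LinearMap.comp_apply, LinearMap.sum_apply, LinearMap.sum_apply, map_sum]
    rfl
  have hEV : HasMajorantHom (g := toB6 g R H) 𝔬.blk 𝔭.blkPX (𝔭.ΦX U β ∘ₗ ∑ a, 𝔬.Rt U a)
      (fun (y y' : g.Site) => NF * (θH β * g.M⁻¹) * (g.len y ^ (1 - β) * (g.len y')⁻¹) *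
        Real.exp (-(δ₀ * g.dist y y'))) := by
    rw [hsumV]
    refine hasMajorantHom_mono (g := toB6 g R H) 𝔬.blk 𝔭.blkPX
      (hasMajorantHom_fintypeSum 𝔬.blk 𝔭.blkPX (fun a => 𝔭.ΦX U β ∘ₗ 𝔬.Rt U a) _ (hF.facT β hβ0 hβ1)) fun y y' => ?_
    have h3 : 0 ≤ (θH β * g.M⁻¹) * (g.len y ^ (1 - β) * (g.len y')⁻¹) * Real.exp (-(δ₀ * g.dist y y')) :=
      mul_nonneg (mul_nonneg (mul_nonneg ht hMinv0) (mul_nonneg (hW y) (inv_nonneg.mpr (hlen y')))) (Real.exp_nonneg _)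
    calc (∑ a, (if y' ∈ 𝔬.SF a then (1 : ℝ) else 0) * (θH β * g.M⁻¹) * (g.len y ^ (1 - β) * (g.len y')⁻¹) *
            Real.exp (-(δ₀ * g.dist y y')))
        = (∑ a, if y' ∈ 𝔬.SF a then (1 : ℝ) else 0) *
            ((θH β * g.M⁻¹) * (g.len y ^ (1 - β) * (g.len y')⁻¹) * Real.exp (-(δ₀ * g.dist y y'))) := by
          rw [Finset.sum_mul]
          exact Finset.sum_congr rfl fun a _ => by ring
      _ ≤ NF * ((θH β * g.M⁻¹) * (g.len y ^ (1 - β) * (g.len y')⁻¹) * Real.exp (-(δ₀ * g.dist y y'))) :=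
          mul_le_mul_of_nonneg_right (hs.cntF y') h3
      _ = NF * (θH β * g.M⁻¹) * (g.len y ^ (1 - β) * (g.len y')⁻¹) * Real.exp (-(δ₀ * g.dist y y')) := by ring
  have eR := rightMember_of_localLegs (R := R) (H := H) 𝔬.blk 𝔬.blkY 𝔭.blkPX d δ₀ α δ (NF * (θH β * g.M⁻¹)) (Bl β) NH C
    (fun y => g.len y ^ (1 - β)) (fun y => g.len y) (fun i (a : g.Site) => if a ∈ SH i then (1 : ℝ) else 0) hb hNH hC
    (mul_nonneg hNF (mul_nonneg ht hMinv0)) hW hs.lenpos hδ hδle hαδ₀ htri hs.dnn h261 hcntH hfixT h2 hEV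
    (hL.right β hβ0 hβ1)
  -- the two constants against `holderConst`
  have hK : 0 ≤ holderConst d δ₀ α NH NF C (Bl β) (θH β) := holderConst_nonneg' hNH hNF hC hb ht
  refine ⟨hasMajorantHom_mono (g := toB6 g R H) 𝔬.blk 𝔭.blkPY eL fun a b => ?_,
    hasMajorantHom_mono (g := toB6 g R H) 𝔬.blkY 𝔭.blkPX eR fun a b => ?_⟩
  · -- NH·Bl·c₁(1 − q)⁻¹ ≤ 2NH·Bl·c₁ ≤ holderConst
    have hinv : (1 - NF * (θ₀ * g.M⁻¹) * B6.c1 d δ₀ α)⁻¹ ≤ 2 := by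
      rw [inv_le_comm₀ (by linarith) (by norm_num : (0 : ℝ) < 2)]
      linarith
    have hA0 : 0 ≤ NH * Bl β * B6.c1 d δ₀ α := mul_nonneg (mul_nonneg hNH hb) hc1
    have h1 : NH * Bl β * B6.c1 d δ₀ α * (1 - NF * (θ₀ * g.M⁻¹) * B6.c1 d δ₀ α)⁻¹ ≤
        holderConst d δ₀ α NH NF C (Bl β) (θH β) := by
      calc NH * Bl β * B6.c1 d δ₀ α * (1 - NF * (θ₀ * g.M⁻¹) * B6.c1 d δ₀ α)⁻¹
          ≤ NH * Bl β * B6.c1 d δ₀ α * 2 := mul_le_mul_of_nonneg_left hinv hA0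
        _ = 2 * NH * Bl β * B6.c1 d δ₀ α := by ring
        _ ≤ holderConst d δ₀ α NH NF C (Bl β) (θH β) := by
            unfold holderConst
            have h0 : 0 ≤ NH * Bl β + NF * θH β * C * B6.c1 d δ₀ α :=
              add_nonneg (mul_nonneg hNH hb) (mul_nonneg (mul_nonneg (mul_nonneg hNF ht) hC) hc1)
            linarith
    exact mul_le_mul (mul_le_mul_of_nonneg_right h1 (hW a)) (hexp a b) (Real.exp_nonneg _) (mul_nonneg hK (hW a))
  · -- NH·Bl + NF·θH·M⁻¹·C·c₁ ≤ holderConst (M ≥ 1)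
    have h1 : NH * Bl β + NF * (θH β * g.M⁻¹) * C * B6.c1 d δ₀ α ≤ holderConst d δ₀ α NH NF C (Bl β) (θH β) := by
      unfold holderConst
      have h2 : NF * (θH β * g.M⁻¹) * C * B6.c1 d δ₀ α ≤ NF * θH β * C * B6.c1 d δ₀ α := by
        have h3 : θH β * g.M⁻¹ ≤ θH β := by
          calc θH β * g.M⁻¹ ≤ θH β * 1 := mul_le_mul_of_nonneg_left hMinv ht
            _ = θH β := mul_one _
        have h4 : 0 ≤ C * B6.c1 d δ₀ α := mul_nonneg hC hc1
        calc NF * (θH β * g.M⁻¹) * C * B6.c1 d δ₀ α = NF * (θH β * g.M⁻¹) * (C * B6.c1 d δ₀ α) := by ring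
          _ ≤ NF * θH β * (C * B6.c1 d δ₀ α) :=
              mul_le_mul_of_nonneg_right (mul_le_mul_of_nonneg_left h3 hNF) h4
          _ = NF * θH β * C * B6.c1 d δ₀ α := by ring
      have h5 : 0 ≤ 2 * NH * Bl β * B6.c1 d δ₀ α := by positivity
      linarith
    exact mul_le_mul_of_nonneg_right (mul_le_mul_of_nonneg_right h1 (hW a)) (Real.exp_nonneg _)

end GSide

end

end Literature.MathematicalPhysics.QuantumFieldTheory.Balaban1983to89.B9RWSums343HolderDir
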